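/-
Copyright (c) 2026 the pub-hodgecm-mathlib formalisation cell (harness21).  Prover seat hodgecm-mathlib-K2E3-p14 (g3), HCML Track B «K2-LIT» (build stream 29),
h413 = `stmt-HodgeConjecture-24833`, line `K2_E3_EllipticInputs`, unit U12 «Characters», socket #11 road (11-SC), letter (SC-an): HARISH-CHANDRA'S THEOREM 20
«cusp-form cancellation», brick (T20-e1) «THE CORE: LEMMA 57 (the one-line cusp integral) AND LEMMA 53 (the Fubini step)», abstract measure-theoretic form
(line lead K2E3-p20 (g3) `CENSUS-Thm20` §4 (T20-e); split (T20-e) = (T20-e1) CORE + (T20-e2) HEIGHTS, K2E3-p21 (g3) `K2/STATUS.md` 2026-09-04T01:48Z).  2026-09-04.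
-/
import Mathlib.MeasureTheory.Integral.Prod
import Mathlib.MeasureTheory.Group.Integral
import Literature.NumberTheory.Automorphic.HaarConjCompact                                  -- ★ `map_mul_right_eq_self_of_mem_isCompact` (a Haar measure is right-invariant under a compact subgroup)
import Summits.HodgeConjecture.HodgeConjecture.Theorems.K2E3CuspFormCancellationHeights     -- ★ (T20-e2) p856608 `cuspForm_trichotomy_support` ∕ `_conjLevel` (Lemmas 54–56, abstract)
import HarnessLib

/-!
# h413 ∕ Track B «K2-LIT», line `K2_E3_EllipticInputs`, unit U12, road (11-SC), letter (SC-an) — Theorem-20 brick (T20-e1): THE CORE OF HARISH-CHANDRA'S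
# CUSP-FORM CANCELLATION — LEMMA 57 (the cusp integral along `N ∩ K′`) AND LEMMA 53 (Fubini over `K′ ⊇ N ∩ K′`), ABSTRACT MEASURE-THEORETIC FORM, AND
# THEOREM 20 = (T20-e2) ∘ (T20-e1) (Harish-Chandra 1970, Part VII §2 p. 70, §8 pp. 80–84)

Cell `pub/hodgecm-mathlib`, crux H413 = `stmt-HodgeConjecture-24833`, route of record `HCCMUnconditional`; chair K2-lead (g0), dealer K2E3-plan (g2), line lead of the
(SC-an) ∕ Theorem-20 bricks K2E3-p20 (g3).  THEOREMS ONLY (no `def`, no `instance`, no `notation`, no named-fact hypothesis, no `sorry`); lane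
`--supports stmt-HodgeConjecture-24833 --as helper`, count-neutral.  Imports: two Mathlib modules, ★ `HaarConjCompact`, ★ (T20-e2), HarnessLib.

THE PRINT [HarishChandra1970, Part VII §8, proof of Theorem 20, pp. 83–84].  After Lemmas 54–56 (★ (T20-e2) `K2E3CuspFormCancellationHeights`, K2E3-p21 (g3)) one knows,
for `f ∈ Φ_C`, `y ∈ G`, `x ∉ ω(C, y)`, `K′ := K₀(y⁻¹) = K₀ ∩ K₀^{y⁻¹}` and every `k ∈ K′`: `x y k = g₀ · n₀` with `n₀ ∈ N′` and «`f(g₀ n) = 0` for `n ∈ N′` unless `n ∈ N′ ∩ K₀(y⁻¹)`».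
LEMMA 57: then `J′(k) := ∫_{N′ ∩ K₀(y⁻¹)} f(x y k n′) dn′ = 0` for every `k ∈ K′` — «`J′(k) = 0` unless `n₀ ∈ N′ ∩ K₀(y⁻¹)`.  Now suppose `n₀ ∈ N′ ∩ K₀(y⁻¹)`.  Then
`f(γ₀(n₀n′)^a) = 0` unless `n′ ∈ N′ ∩ K₀(y⁻¹)`.  Hence `J′(k) = ∫_{N′ ∩ K₀(y⁻¹)} = ∫_{N′} = 0`» (the cusp condition (ii) of `Φ_C`).  LEMMA 53: «write
`J(x) = ∫_{K₀(y⁻¹)} f(xyk) dk = ∫_{K₀(y⁻¹)/K₀(y⁻¹)∩N′} dk̇ ∫_{K₀(y⁻¹)∩N′} f(xykn′) dn′`; Lemma 53 follows now easily from Lemma 57».  Here the quotient-measure bookkeeping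
is replaced by a Fubini step on the finite product `μ|K′ ⊗ ν|(N ∩ K′)` and the right-invariance of `μ` under the compact `K′`: `ν(N∩K′) · J(x) = ∫_{K′} J′(k) dμ(k) = 0`.

ABSTRACT CURRENCY (instantiated at `U(σ, Φ₃)(L⁺_v)` by (T20-f); the bookkeeping hypotheses are EXACTLY the output of ★ (T20-e2)).  `G` a second-countable locally compact
group with a measure `μ` (s-finite, finite on the compact open subgroup `K′ ≤ G`, right-invariant under `K′` — AUTOMATIC for every left Haar measure by ★
`map_mul_right_eq_self_of_mem_isCompact`, so NO unimodularity of `G` is assumed in §1–§4); a CLOSED subgroup `N ≤ G` carrying a left-invariant measure `ν` on `↥N`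
(positive on opens, finite on compacts, s-finite: any Haar measure — the ★ K2E1 cusp currency `∫ n : ↥N, θ (x * ↑n) ∂ν`); a continuous `f : G → E` which is a CUSP
FORM ALONG `N`: `∀ x, ∫ n : ↥N, f (x * ↑n) ∂ν = 0`.  (Print's right-`A`-invariance of `f` is not needed: ★ (T20-e2) keeps `a` inside `g₀ = γ₀ a`.)

* §1 LEMMA 57 `setIntegral_subgroup_eq_zero_of_factorisation`: if `w = g₀ n₀` (`n₀ ∈ N`) and `∀ n ∈ N, f (g₀ n) ≠ 0 → n ∈ K′`, then `∫_{n ∈ N ∩ K′} f(w n) dν = 0`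
  (pure left-invariance of `ν`; no topology on `G` beyond measurability).
* §2 LEMMA 53 `setIntegral_eq_zero_of_forall_setIntegral_subgroup_eq_zero`: if `∫_{n ∈ N ∩ K′} F(k n) dν = 0` for every `k ∈ K′` then `∫_{k ∈ K′} F(k) dμ = 0`
  (Fubini + right-`K′`-invariance of `μ` + `0 < ν(N ∩ K′) < ∞`).
* §3 THE CORE `setIntegral_mul_eq_zero_of_cuspForm` (= Lemma 53 ∘ Lemma 57, the hypothesis shape `hk` of ★ (T20-e2)'s second∕third disjunct), its trivial companion
  `setIntegral_mul_eq_zero_of_forall_eq_zero` (first disjunct), the three-way wrapper `setIntegral_mul_eq_zero_of_trichotomy`, and the HAAR reading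
  `setIntegral_mul_eq_zero_of_trichotomy_haar` (`μ` any left Haar measure on `G`).
* §4 THEOREM 20 (abstract, rank-one shape `𝒫′ = {(B,A),(B̄,A)}`) = (T20-e2) ∘ (T20-e1): **`cuspForm_cancellation`** (sub-level `K′` with a deep level `L j₀ ≤ K′ ≤ K₀`) and
  **`cuspForm_cancellation_conjLevel`** (`K′ = K₀(y⁻¹) = K₀ ∩ y⁻¹K₀y`, `j₀ = m + 2s`): for `y ∈ Ω s` and `x ∉ Ω (m_C + (j₀ + 4 m_C) + s)` — print's `x ∉ ω(C, y)` with an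
  explicit linear constant — `∫_{k ∈ K′} f(x y k) dμ = 0`.
* SEQUEL (separate file `K2E3CuspFormCancellationLevelOne`, same seat): print's first line «`J(x) = ∫_{K₀(y)} f(xky) dk = ∫_{K₀(y⁻¹)} f(xyk) dk`» (the only place where
  invariance of `μ` under the NON-compact `y`, i.e. unimodularity, enters) and the upgrade from `K₀(y)` to the full level `K₁` («`k` runs over representatives of
  `K₁/K₀(y₀)`», p. 71) by the same Fubini averaging as §2.

HONEST LABEL.  HC_CM is proved only modulo the 7 printed citations (2 remaining named inputs: hLiu418 = `stmt-HodgeConjecture-24832`, h413 = `stmt-HodgeConjecture-24833`)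
until rung 0 closes; this file is a count-neutral helper (the measure-theoretic half of print's proof of Theorem 20, abstractly; nothing printed is asserted as a fact).

## References
* [HarishChandra1970] Harish-Chandra (notes by G. van Dijk), *Harmonic Analysis on Reductive p-adic Groups*, LNM 162 (1970), Part VII §2 p. 70 (Theorem 20), §8 pp. 80–84
  (Lemmas 53–57; Lemma 57 and the end of the proof p. 84).
* [Folland1995] G. B. Folland, *A Course in Abstract Harmonic Analysis* (1995), §2.4 (compact subgroups lie in the kernel of the modular function), §2.6 (Fubini on groups).
-/

set_option autoImplicit false
set_option linter.dupNamespace false  -- the mandated namespace repeats the single-problem summit's segment (`HodgeConjecture.HodgeConjecture`)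

noncomputable section

open MeasureTheory MeasureTheory.Measure Topology Set
open scoped Pointwise ENNReal

namespace Summit.HodgeConjecture.HodgeConjecture.Cruxes.H413.K2E3CuspFormCancellationCore

variable {G : Type*} [Group G] [TopologicalSpace G] [IsTopologicalGroup G] [MeasurableSpace G] [BorelSpace G]
variable {E : Type*} [NormedAddCommGroup E] [NormedSpace ℝ E]

/-! ## §1 Lemma 57: the integral along `N ∩ K′` vanishes -/

section Lemma57

variable (N K' : Subgroup G) (ν : Measure ↥N) [ν.IsMulLeftInvariant]

/-- **LEMMA 57** (abstract).  Let `ν` be a left-invariant measure on the subgroup `N`, `f` a cusp form along `N` (`∫_N f(x n) dν(n) = 0` for every `x`), and suppose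
`w = g₀ n₀` with `n₀ ∈ N` and «`f(g₀ n) ≠ 0`, `n ∈ N` ⟹ `n ∈ K′`».  Then `∫_{n ∈ N ∩ K′} f(w n) dν(n) = 0`.  Print: «`J′(k) = 0` unless `n₀ ∈ N′ ∩ K₀(y⁻¹)`» (if `n₀ ∉ K′`
the integrand `f(g₀ (n₀ n))` vanishes identically on `N ∩ K′`); «now suppose `n₀ ∈ N′ ∩ K₀(y⁻¹)`; then `f(γ₀(n₀n′)^a) = 0` unless `n′ ∈ N′ ∩ K₀(y⁻¹)`, hence
`J′(k) = ∫_{N′∩K₀(y⁻¹)} = ∫_{N′} f = 0`» (extend to all of `N`, translate by `n₀`, apply the cusp condition at the base point `g₀`).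
[cite: HarishChandra1970, Part VII §8 Lemma 57 pp. 83–84] -/
theorem setIntegral_subgroup_eq_zero_of_factorisation (f : G → E) (hcusp : ∀ x : G, ∫ n : ↥N, f (x * ↑n) ∂ν = 0)
    {w g₀ n₀ : G} (hn₀ : n₀ ∈ N) (hw : w = g₀ * n₀) (hvan : ∀ n ∈ N, f (g₀ * n) ≠ 0 → n ∈ K') :
    ∫ n in {n : ↥N | (n : G) ∈ K'}, f (w * ↑n) ∂ν = 0 := by
  -- `f(g₀ (n₀ n)) ≠ 0 ⟹ n₀ n ∈ K′`
  have hkey : ∀ n : ↥N, f (w * ↑n) ≠ 0 → n₀ * (n : G) ∈ K' := fun n hn =>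
    hvan (n₀ * ↑n) (N.mul_mem hn₀ n.2) (by rwa [← mul_assoc, ← hw])
  by_cases hn₀K : n₀ ∈ K'
  · -- the integrand vanishes OFF `N ∩ K′`: the set integral is the full integral, a left translate of the cusp integral at `g₀`
    have hoff : ∀ n : ↥N, n ∉ {n : ↥N | (n : G) ∈ K'} → f (w * ↑n) = 0 := by
      intro n hn
      by_contra hne
      apply hn
      have h := K'.mul_mem (K'.inv_mem hn₀K) (hkey n hne)
      rwa [inv_mul_cancel_left] at h
    rw [setIntegral_eq_integral_of_forall_compl_eq_zero hoff]
    have hfun : (fun n : ↥N => f (w * ↑n)) = fun n : ↥N => (fun m : ↥N => f (g₀ * ↑m)) ((⟨n₀, hn₀⟩ : ↥N) * n) := by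
      funext n
      simp only [Subgroup.coe_mul, hw, mul_assoc]
    rw [hfun, integral_mul_left_eq_self (fun m : ↥N => f (g₀ * ↑m)) (⟨n₀, hn₀⟩ : ↥N)]
    exact hcusp g₀
  · -- the integrand vanishes ON `N ∩ K′`
    refine setIntegral_eq_zero_of_forall_eq_zero fun n hn => ?_
    by_contra hne
    apply hn₀K
    have h := K'.mul_mem (hkey n hne) (K'.inv_mem hn)
    rwa [mul_inv_cancel_right] at h

end Lemma57

/-! ## §2 Lemma 53: Fubini over `K′ ⊇ N ∩ K′` and the right-invariance of `μ` under `K′` -/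

section Lemma53

variable [SecondCountableTopology G] (μ : Measure G) [SFinite μ] (K' : Subgroup G)

/-- **THE AVERAGING STEP BEHIND LEMMA 53** (abstract Fubini form, stated for a parameter space `Y → G` so that it serves both `Y = ↥N` — Lemma 53 — and `Y = G` —
the passage from `K₀(y)` to `K₁` on p. 71).  `K′ ≤ G` compact (measurable) with `μ(K′) < ∞` and `μ` right-invariant under `K′`; `ν` a measure on `Y`, `φ : Y → G`
continuous, `S ⊆ Y` measurable and compact with `0 < ν(S) < ∞` and `φ(S) ⊆ K′`; `F : G → E` continuous.  If `∫_{y ∈ S} F(k·φ(y)) dν(y) = 0` for every `k ∈ K′` then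
`∫_{k ∈ K′} F(k) dμ(k) = 0`: indeed `0 = ∫_{K′} ∫_S F(k φ(y)) dν dμ = ∫_S ∫_{K′} F(k φ(y)) dμ dν` (Fubini: continuous integrand, bounded on the compact `K′ × S`, finite
product measure) `= ∫_S ∫_{K′} F(k) dμ dν` (`k ↦ k·φ(y)` preserves `μ` and `K′`) `= ν(S) · ∫_{K′} F dμ`.  This replaces print's quotient integral
`∫_{K′/(K′∩N′)} dk̇ ∫_{K′∩N′} dn′`. [cite: HarishChandra1970, Part VII §8 Lemma 53 p. 81, end of proof p. 84] [cite: Folland1995, §2.4, §2.6] -/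
theorem setIntegral_eq_zero_of_forall_setIntegral_comp_eq_zero {Y : Type*} [TopologicalSpace Y] [MeasurableSpace Y] [BorelSpace Y]
    [SecondCountableTopology Y] (ν : Measure Y) [SFinite ν] (φ : Y → G) (hφ : Continuous φ)
    (S : Set Y) (hSmeas : MeasurableSet S) (hSc : IsCompact S) (hS0 : ν S ≠ 0) (hSfin : ν S < ∞) (hSK : ∀ y ∈ S, φ y ∈ K')
    (hK'meas : MeasurableSet (K' : Set G)) (hK'c : IsCompact (K' : Set G)) (hμfin : μ K' < ∞) (hμK' : ∀ k ∈ K', μ.map (· * k) = μ)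
    (F : G → E) (hF : Continuous F) (h : ∀ k ∈ K', ∫ y in S, F (k * φ y) ∂ν = 0) :
    ∫ k in (K' : Set G), F k ∂μ = 0 := by
  -- the iterated integral vanishes
  have hI : ∫ k in (K' : Set G), (∫ y in S, F (k * φ y) ∂ν) ∂μ = 0 :=
    setIntegral_eq_zero_of_forall_eq_zero fun k hk => h k hk
  -- Fubini on the finite product `μ|K′ ⊗ ν|S` for the continuous (hence bounded on the compact `K′ × S`) integrand
  have hint : Integrable (Function.uncurry fun (k : G) (y : Y) => F (k * φ y))
      ((μ.restrict (K' : Set G)).prod (ν.restrict S)) := by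
    haveI : IsFiniteMeasure (μ.restrict (K' : Set G)) := isFiniteMeasure_restrict.2 hμfin.ne
    haveI : IsFiniteMeasure (ν.restrict S) := isFiniteMeasure_restrict.2 hSfin.ne
    have hcont : Continuous (Function.uncurry fun (k : G) (y : Y) => F (k * φ y)) :=
      hF.comp (continuous_fst.mul (hφ.comp continuous_snd))
    obtain ⟨C, hC⟩ := (hK'c.prod hSc).exists_bound_of_continuousOn hcont.continuousOn
    refine Integrable.of_bound hcont.aestronglyMeasurable C ?_
    rw [Measure.prod_restrict]
    filter_upwards [ae_restrict_mem (hK'meas.prod hSmeas)] with p hp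
    exact hC p hp
  have hswap : ∫ k in (K' : Set G), (∫ y in S, F (k * φ y) ∂ν) ∂μ = ∫ y in S, (∫ k in (K' : Set G), F (k * φ y) ∂μ) ∂ν :=
    integral_integral_swap hint
  -- right-invariance of `μ` under `φ(y) ∈ K′`: the inner integral is the constant `J = ∫_{K′} F dμ` on `S`
  have hinner : EqOn (fun y : Y => ∫ k in (K' : Set G), F (k * φ y) ∂μ) (fun _ => ∫ k in (K' : Set G), F k ∂μ) S := by
    intro y hy
    have hn := hSK y hy
    have hpre : (fun k : G => k * φ y) ⁻¹' (K' : Set G) = K' := by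
      ext k
      simp only [mem_preimage, SetLike.mem_coe]
      refine ⟨fun hk => ?_, fun hk => K'.mul_mem hk hn⟩
      have h' := K'.mul_mem hk (K'.inv_mem hn)
      rwa [mul_inv_cancel_right] at h'
    have hmap := setIntegral_map_equiv (μ := μ) (MeasurableEquiv.mulRight (φ y)) F (K' : Set G)
    rw [MeasurableEquiv.coe_mulRight, hμK' _ hn, hpre] at hmap
    exact hmap.symm
  have hconst : ∫ y in S, (∫ k in (K' : Set G), F (k * φ y) ∂μ) ∂ν = (ν S).toReal • ∫ k in (K' : Set G), F k ∂μ := by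
    rw [setIntegral_congr_fun hSmeas hinner]
    by_cases hE : CompleteSpace E
    · rw [setIntegral_const, measureReal_def]
    · simp [integral, hE]
  have hne : (ν S).toReal ≠ 0 := ENNReal.toReal_ne_zero.2 ⟨hS0, hSfin.ne⟩
  rw [hswap, hconst] at hI
  exact (smul_eq_zero.1 hI).resolve_left hne

variable (N : Subgroup G) (ν : Measure ↥N) [SFinite ν] [ν.IsOpenPosMeasure] [IsFiniteMeasureOnCompacts ν]

/-- **LEMMA 53** (abstract; the Fubini step along `N ∩ K′`).  `N ≤ G` closed, `K′ ≤ G` compact open with `μ(K′) < ∞` and `μ` right-invariant under `K′`; `ν` on `↥N`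
positive on opens and finite on compacts; `F : G → E` continuous.  If `∫_{n ∈ N ∩ K′} F(k n) dν(n) = 0` for every `k ∈ K′` then `∫_{k ∈ K′} F(k) dμ(k) = 0` — the averaging
step with `Y = ↥N`, `S = N ∩ K′` (open and compact in `↥N` because `N` is closed, so `0 < ν(S) < ∞`); print: «`J(x) = ∫_{K₀(y⁻¹)/K₀(y⁻¹)∩N′} dk̇ ∫_{K₀(y⁻¹)∩N′} f(xykn′) dn′`.
Lemma 53 follows now easily from Lemma 57». [cite: HarishChandra1970, Part VII §8 Lemma 53 p. 81, end of proof p. 84] [cite: Folland1995, §2.4, §2.6] -/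
theorem setIntegral_eq_zero_of_forall_setIntegral_subgroup_eq_zero (hN : IsClosed (N : Set G)) (hK'o : IsOpen (K' : Set G))
    (hK'c : IsCompact (K' : Set G)) (hμfin : μ K' < ∞) (hμK' : ∀ k ∈ K', μ.map (· * k) = μ)
    (F : G → E) (hF : Continuous F) (h : ∀ k ∈ K', ∫ n in {n : ↥N | (n : G) ∈ K'}, F (k * ↑n) ∂ν = 0) :
    ∫ k in (K' : Set G), F k ∂μ = 0 := by
  haveI : SecondCountableTopology ↥N := TopologicalSpace.Subtype.secondCountableTopology (N : Set G)
  -- `S = N ∩ K′ ⊆ ↥N` is open and compact, hence of positive finite measure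
  have hSo : IsOpen {n : ↥N | (n : G) ∈ K'} := hK'o.preimage continuous_subtype_val
  have hSc : IsCompact {n : ↥N | (n : G) ∈ K'} := hN.isClosedEmbedding_subtypeVal.isCompact_preimage hK'c
  have hSpos : 0 < ν {n : ↥N | (n : G) ∈ K'} := hSo.measure_pos ν ⟨1, show ((1 : ↥N) : G) ∈ K' from K'.one_mem⟩
  exact setIntegral_eq_zero_of_forall_setIntegral_comp_eq_zero μ K' ν ((↑) : ↥N → G) continuous_subtype_val {n : ↥N | (n : G) ∈ K'}
    hSo.measurableSet hSc hSpos.ne' hSc.measure_lt_top (fun _ hn => hn) hK'o.measurableSet hK'c hμfin hμK' F hF h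

end Lemma53

/-! ## §3 The core: Lemma 53 ∘ Lemma 57, and the three-way wrapper eating ★ (T20-e2)'s trichotomy -/

section Core

variable [SecondCountableTopology G] (μ : Measure G) [SFinite μ] (N K' : Subgroup G)
  (ν : Measure ↥N) [SFinite ν] [ν.IsOpenPosMeasure] [IsFiniteMeasureOnCompacts ν] [ν.IsMulLeftInvariant]

/-- **THE CORE CANCELLATION LEMMA (T20-e1)** = Lemma 53 ∘ Lemma 57.  `N ≤ G` closed with a left-invariant `ν` on `↥N` (positive on opens, finite on compacts); `K′ ≤ G`
compact open, `μ(K′) < ∞`, `μ` right-invariant under `K′`; `f : G → E` continuous and a cusp form along `N`.  If every `k ∈ K′` admits `z k = g₀ n₀` (`n₀ ∈ N`) with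
«`f(g₀ n) ≠ 0`, `n ∈ N` ⟹ `n ∈ K′`» — the second disjunct of ★ `cuspForm_trichotomy_support` — then `∫_{k ∈ K′} f(z k) dμ(k) = 0`.
[cite: HarishChandra1970, Part VII §8 Lemmas 53 and 57, pp. 81–84] -/
theorem setIntegral_mul_eq_zero_of_cuspForm (hN : IsClosed (N : Set G)) (hK'o : IsOpen (K' : Set G)) (hK'c : IsCompact (K' : Set G))
    (hμfin : μ K' < ∞) (hμK' : ∀ k ∈ K', μ.map (· * k) = μ)
    (f : G → E) (hf : Continuous f) (hcusp : ∀ x : G, ∫ n : ↥N, f (x * ↑n) ∂ν = 0)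
    {z : G} (hk : ∀ k ∈ K', ∃ g₀ : G, ∃ n₀ ∈ N, z * k = g₀ * n₀ ∧ ∀ n ∈ N, f (g₀ * n) ≠ 0 → n ∈ K') :
    ∫ k in (K' : Set G), f (z * k) ∂μ = 0 := by
  refine setIntegral_eq_zero_of_forall_setIntegral_subgroup_eq_zero μ K' N ν hN hK'o hK'c hμfin hμK' (fun g => f (z * g))
    (hf.comp (continuous_const_mul z)) fun k hkK => ?_
  obtain ⟨g₀, n₀, hn₀, hzk, hvan⟩ := hk k hkK
  have h57 := setIntegral_subgroup_eq_zero_of_factorisation N K' ν f hcusp hn₀ hzk hvan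
  simpa only [mul_assoc] using h57

omit [TopologicalSpace G] [IsTopologicalGroup G] [BorelSpace G] [SecondCountableTopology G] [SFinite μ] in
/-- The trivial companion (first disjunct of ★ `cuspForm_trichotomy_support`): if `f(z k) = 0` for every `k ∈ K′` then `∫_{k ∈ K′} f(z k) dμ = 0`.
[cite: HarishChandra1970, Part VII §8 p. 81] -/
theorem setIntegral_mul_eq_zero_of_forall_eq_zero (f : G → E) {z : G} (h0 : ∀ k ∈ K', f (z * k) = 0) :
    ∫ k in (K' : Set G), f (z * k) ∂μ = 0 :=
  setIntegral_eq_zero_of_forall_eq_zero fun k hk => h0 k hk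

variable (Nbar : Subgroup G) (νbar : Measure ↥Nbar) [SFinite νbar] [νbar.IsOpenPosMeasure] [IsFiniteMeasureOnCompacts νbar] [νbar.IsMulLeftInvariant]

/-- **THE THREE-WAY WRAPPER**: the conclusion shape of ★ (T20-e2) `cuspForm_trichotomy_support` (EITHER `f(z k) = 0` on `K′`, OR the factorisation pattern along `N`,
OR along `N̄`), for `f` a cusp form along BOTH `N` and `N̄` (closed subgroups with left-invariant measures `ν`, `ν̄`), gives `∫_{k ∈ K′} f(z k) dμ = 0`.
[cite: HarishChandra1970, Part VII §8 pp. 80–84, Lemmas 53–57] -/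
theorem setIntegral_mul_eq_zero_of_trichotomy (hN : IsClosed (N : Set G)) (hNbar : IsClosed (Nbar : Set G))
    (hK'o : IsOpen (K' : Set G)) (hK'c : IsCompact (K' : Set G)) (hμfin : μ K' < ∞) (hμK' : ∀ k ∈ K', μ.map (· * k) = μ)
    (f : G → E) (hf : Continuous f) (hcusp : ∀ x : G, ∫ n : ↥N, f (x * ↑n) ∂ν = 0) (hcuspbar : ∀ x : G, ∫ v : ↥Nbar, f (x * ↑v) ∂νbar = 0)
    {z : G}
    (htri : (∀ k ∈ K', f (z * k) = 0) ∨
      (∀ k ∈ K', ∃ g₀ : G, ∃ n₀ ∈ N, z * k = g₀ * n₀ ∧ ∀ n ∈ N, f (g₀ * n) ≠ 0 → n ∈ K') ∨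
      (∀ k ∈ K', ∃ g₀ : G, ∃ v₀ ∈ Nbar, z * k = g₀ * v₀ ∧ ∀ v ∈ Nbar, f (g₀ * v) ≠ 0 → v ∈ K')) :
    ∫ k in (K' : Set G), f (z * k) ∂μ = 0 := by
  rcases htri with h0 | hkN | hkNbar
  · exact setIntegral_mul_eq_zero_of_forall_eq_zero μ K' f h0
  · exact setIntegral_mul_eq_zero_of_cuspForm μ N K' ν hN hK'o hK'c hμfin hμK' f hf hcusp hkN
  · exact setIntegral_mul_eq_zero_of_cuspForm μ Nbar K' νbar hNbar hK'o hK'c hμfin hμK' f hf hcuspbar hkNbar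

end Core

/-! ### The Haar reading: every left Haar measure on `G` is right-invariant under the compact `K′` (★ `HaarConjCompact`), so `μ` Haar suffices -/

section Haar

variable [SecondCountableTopology G] [LocallyCompactSpace G] (μ : Measure G) [μ.IsHaarMeasure] (N K' Nbar : Subgroup G)
  (ν : Measure ↥N) [SFinite ν] [ν.IsOpenPosMeasure] [IsFiniteMeasureOnCompacts ν] [ν.IsMulLeftInvariant]
  (νbar : Measure ↥Nbar) [SFinite νbar] [νbar.IsOpenPosMeasure] [IsFiniteMeasureOnCompacts νbar] [νbar.IsMulLeftInvariant]

/-- **THE CORE FOR A HAAR MEASURE `μ` ON `G`** (no unimodularity of `G` needed): a left Haar measure is finite on the compact `K′` and right-invariant under it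
(★ `map_mul_right_eq_self_of_mem_isCompact`: the modular function is trivial on compact subgroups), so `setIntegral_mul_eq_zero_of_trichotomy` applies to it.
[cite: HarishChandra1970, Part VII §8 pp. 80–84, Lemmas 53–57] [cite: Folland1995, §2.4] -/
theorem setIntegral_mul_eq_zero_of_trichotomy_haar (hN : IsClosed (N : Set G)) (hNbar : IsClosed (Nbar : Set G))
    (hK'o : IsOpen (K' : Set G)) (hK'c : IsCompact (K' : Set G))
    (f : G → E) (hf : Continuous f) (hcusp : ∀ x : G, ∫ n : ↥N, f (x * ↑n) ∂ν = 0) (hcuspbar : ∀ x : G, ∫ v : ↥Nbar, f (x * ↑v) ∂νbar = 0)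
    {z : G}
    (htri : (∀ k ∈ K', f (z * k) = 0) ∨
      (∀ k ∈ K', ∃ g₀ : G, ∃ n₀ ∈ N, z * k = g₀ * n₀ ∧ ∀ n ∈ N, f (g₀ * n) ≠ 0 → n ∈ K') ∨
      (∀ k ∈ K', ∃ g₀ : G, ∃ v₀ ∈ Nbar, z * k = g₀ * v₀ ∧ ∀ v ∈ Nbar, f (g₀ * v) ≠ 0 → v ∈ K')) :
    ∫ k in (K' : Set G), f (z * k) ∂μ = 0 :=
  setIntegral_mul_eq_zero_of_trichotomy μ N K' ν Nbar νbar hN hNbar hK'o hK'c hK'c.measure_lt_top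
    (fun _ hk => Literature.NumberTheory.Automorphic.map_mul_right_eq_self_of_mem_isCompact μ hK'c hk) f hf hcusp hcuspbar htri

end Haar

/-! ## §4 THEOREM 20 (abstract, rank-one shape) = ★ (T20-e2) ∘ (T20-e1) -/

section Theorem20

variable [SecondCountableTopology G] [LocallyCompactSpace G] (μ : Measure G) [μ.IsHaarMeasure]
  (Ω : ℕ → Set G) (K₀ K' T N Nbar A : Subgroup G) (Aplus Aminus : Set G) (L : ℕ → Subgroup G)
  (ν : Measure ↥N) [SFinite ν] [ν.IsOpenPosMeasure] [IsFiniteMeasureOnCompacts ν] [ν.IsMulLeftInvariant]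
  (νbar : Measure ↥Nbar) [SFinite νbar] [νbar.IsOpenPosMeasure] [IsFiniteMeasureOnCompacts νbar] [νbar.IsMulLeftInvariant]

/-- **THEOREM 20 (HARISH-CHANDRA'S CUSP-FORM CANCELLATION), ABSTRACT RANK-ONE FORM** = ★ (T20-e2) `cuspForm_trichotomy_support` ∘ (T20-e1) `setIntegral_mul_eq_zero_of_trichotomy_haar`.
DATA (all discharged at `U(σ,Φ₃)(L⁺_v)` from ★ bricks, see ★ (T20-e2)'s «DISCHARGE»): height balls `Ω` (`Ω a·Ω b ⊆ Ω (a+b)`, inversion-stable; ★ p856390); a level `K₀ ⊆ Ω 0`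
with BOTH Iwahori orders along `(T, N, N̄)` (★ (T20-c)); a compact open sub-level `K′ ≤ K₀` containing a deep level `L j₀` (★ (T20-c) §3); `A = A⁺ ∪ A⁻` normalising `N`, `N̄`,
conjugating `K₀ ⊓ T` into `K₀`, with the one-sided contractions (★ (T20-d)) and Lemma 54's inputs; `N`, `N̄` CLOSED with left-invariant measures `ν`, `ν̄` (positive on
opens, finite on compacts); `μ` a left Haar measure on `G`; and `f : G → E` CONTINUOUS, supported in `C·A` with `C ⊆ Ω m_C`, and a CUSP FORM along `N` and `N̄`.
CONCLUSION: for `y ∈ Ω s` and `x ∉ Ω (m_C + (j₀ + 4 m_C) + s)` (print's `1 + σ(x) > c(1+σ(C))(1+σ(y))`, `c` explicit and linear), **`∫_{k ∈ K′} f(x y k) dμ(k) = 0`**.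
[cite: HarishChandra1970, Part VII §2 Theorem 20 p. 70; §8 pp. 80–84, Lemmas 53–57] -/
theorem cuspForm_cancellation
    (hΩmul : ∀ {a b : ℕ} {g g' : G}, g ∈ Ω a → g' ∈ Ω b → g * g' ∈ Ω (a + b)) (hΩinv : ∀ {a : ℕ} {g : G}, g ∈ Ω a → g⁻¹ ∈ Ω a)
    (hK₀ : (K₀ : Set G) ⊆ Ω 0) (hK' : K' ≤ K₀) {j₀ : ℕ} (hL : L j₀ ≤ K')
    (hK'o : IsOpen (K' : Set G)) (hK'c : IsCompact (K' : Set G)) (hN : IsClosed (N : Set G)) (hNbar : IsClosed (Nbar : Set G))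
    (f : G → E) (hf : Continuous f) (C : Set G) {mC : ℕ} (hC : C ⊆ Ω mC) (hsupp : ∀ g, f g ≠ 0 → g ∈ C * (A : Set G))
    (hcusp : ∀ x : G, ∫ n : ↥N, f (x * ↑n) ∂ν = 0) (hcuspbar : ∀ x : G, ∫ v : ↥Nbar, f (x * ↑v) ∂νbar = 0)
    (hAcover : ∀ a ∈ A, a ∈ Aplus ∨ a ∈ Aminus)
    (hIw : ∀ k ∈ K₀, ∃ v ∈ K₀ ⊓ Nbar, ∃ t ∈ K₀ ⊓ T, ∃ u ∈ K₀ ⊓ N, k = v * t * u)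
    (hIw' : ∀ k ∈ K₀, ∃ u ∈ K₀ ⊓ N, ∃ t ∈ K₀ ⊓ T, ∃ v ∈ K₀ ⊓ Nbar, k = u * t * v)
    (hT : ∀ a ∈ A, ∀ t ∈ K₀ ⊓ T, a * t * a⁻¹ ∈ K₀)
    (hnormN : ∀ a ∈ A, ∀ n ∈ N, a * n * a⁻¹ ∈ N) (hnormNbar : ∀ a ∈ A, ∀ v ∈ Nbar, a * v * a⁻¹ ∈ Nbar)
    (h54N : ∀ n ∈ N, ∀ a' ∈ A, ∀ c : ℕ, n * a' ∈ Ω c → n ∈ Ω (2 * c))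
    (h54Nbar : ∀ v ∈ Nbar, ∀ a' ∈ A, ∀ c : ℕ, v * a' ∈ Ω c → v ∈ Ω (2 * c))
    (hplusV : ∀ a ∈ Aplus, ∀ v ∈ K₀ ⊓ Nbar, a * v * a⁻¹ ∈ K₀)
    (hplusC : ∀ a ∈ Aplus, ∀ (h c j : ℕ), a ∉ Ω h → j + c ≤ h + 1 → ∀ n ∈ N, n ∈ Ω c → a⁻¹ * n * a ∈ L j)
    (hminusV : ∀ a ∈ Aminus, ∀ u ∈ K₀ ⊓ N, a * u * a⁻¹ ∈ K₀)
    (hminusC : ∀ a ∈ Aminus, ∀ (h c j : ℕ), a ∉ Ω h → j + c ≤ h + 1 → ∀ v ∈ Nbar, v ∈ Ω c → a⁻¹ * v * a ∈ L j)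
    {s : ℕ} {x y : G} (hy : y ∈ Ω s) (hx : x ∉ Ω (mC + (j₀ + 4 * mC) + s)) :
    ∫ k in (K' : Set G), f (x * y * k) ∂μ = 0 :=
  setIntegral_mul_eq_zero_of_trichotomy_haar μ N K' Nbar ν νbar hN hNbar hK'o hK'c f hf hcusp hcuspbar
    (K2E3CuspFormCancellationHeights.cuspForm_trichotomy_support Ω hΩmul hΩinv K₀ K' T N Nbar A Aplus Aminus L hK₀ hK' hL f C hC hsupp hAcover hIw hIw'
      hT hnormN hnormNbar h54N h54Nbar hplusV hplusC hminusV hminusC hy hx)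

/-- **THEOREM 20 AT THE CONJUGATE LEVEL `K′ = K₀(y⁻¹) = K₀ ∩ y⁻¹K₀y`** (membership `k ∈ K₀ ∧ y k y⁻¹ ∈ K₀`; deep index `j₀ = m + 2s` fed by the (T20-c)-shaped
containment «`∀ u ∈ L (m+2s), u ∈ K₀ ∧ y u y⁻¹ ∈ K₀`», ★ `conj_mem_comap_congruenceGL_of_heightBall`): for `y ∈ Ω s` and `x ∉ Ω (m_C + (m + 2s + 4 m_C) + s)`,
**`J(x) = ∫_{K₀(y⁻¹)} f(x y k) dμ(k) = 0`** — print's conclusion after its first change of variables. [cite: HarishChandra1970, Part VII §2 Theorem 20 p. 70; §8 pp. 80–84] -/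
theorem cuspForm_cancellation_conjLevel
    (hΩmul : ∀ {a b : ℕ} {g g' : G}, g ∈ Ω a → g' ∈ Ω b → g * g' ∈ Ω (a + b)) (hΩinv : ∀ {a : ℕ} {g : G}, g ∈ Ω a → g⁻¹ ∈ Ω a)
    (hK₀ : (K₀ : Set G) ⊆ Ω 0) {m s : ℕ} {y : G} (hy : y ∈ Ω s)
    (hK'y : ∀ k, k ∈ K' ↔ k ∈ K₀ ∧ y * k * y⁻¹ ∈ K₀) (hdeep : ∀ u ∈ L (m + 2 * s), u ∈ K₀ ∧ y * u * y⁻¹ ∈ K₀)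
    (hK'o : IsOpen (K' : Set G)) (hK'c : IsCompact (K' : Set G)) (hN : IsClosed (N : Set G)) (hNbar : IsClosed (Nbar : Set G))
    (f : G → E) (hf : Continuous f) (C : Set G) {mC : ℕ} (hC : C ⊆ Ω mC) (hsupp : ∀ g, f g ≠ 0 → g ∈ C * (A : Set G))
    (hcusp : ∀ x : G, ∫ n : ↥N, f (x * ↑n) ∂ν = 0) (hcuspbar : ∀ x : G, ∫ v : ↥Nbar, f (x * ↑v) ∂νbar = 0)
    (hAcover : ∀ a ∈ A, a ∈ Aplus ∨ a ∈ Aminus)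
    (hIw : ∀ k ∈ K₀, ∃ v ∈ K₀ ⊓ Nbar, ∃ t ∈ K₀ ⊓ T, ∃ u ∈ K₀ ⊓ N, k = v * t * u)
    (hIw' : ∀ k ∈ K₀, ∃ u ∈ K₀ ⊓ N, ∃ t ∈ K₀ ⊓ T, ∃ v ∈ K₀ ⊓ Nbar, k = u * t * v)
    (hT : ∀ a ∈ A, ∀ t ∈ K₀ ⊓ T, a * t * a⁻¹ ∈ K₀)
    (hnormN : ∀ a ∈ A, ∀ n ∈ N, a * n * a⁻¹ ∈ N) (hnormNbar : ∀ a ∈ A, ∀ v ∈ Nbar, a * v * a⁻¹ ∈ Nbar)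
    (h54N : ∀ n ∈ N, ∀ a' ∈ A, ∀ c : ℕ, n * a' ∈ Ω c → n ∈ Ω (2 * c))
    (h54Nbar : ∀ v ∈ Nbar, ∀ a' ∈ A, ∀ c : ℕ, v * a' ∈ Ω c → v ∈ Ω (2 * c))
    (hplusV : ∀ a ∈ Aplus, ∀ v ∈ K₀ ⊓ Nbar, a * v * a⁻¹ ∈ K₀)
    (hplusC : ∀ a ∈ Aplus, ∀ (h c j : ℕ), a ∉ Ω h → j + c ≤ h + 1 → ∀ n ∈ N, n ∈ Ω c → a⁻¹ * n * a ∈ L j)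
    (hminusV : ∀ a ∈ Aminus, ∀ u ∈ K₀ ⊓ N, a * u * a⁻¹ ∈ K₀)
    (hminusC : ∀ a ∈ Aminus, ∀ (h c j : ℕ), a ∉ Ω h → j + c ≤ h + 1 → ∀ v ∈ Nbar, v ∈ Ω c → a⁻¹ * v * a ∈ L j)
    {x : G} (hx : x ∉ Ω (mC + (m + 2 * s + 4 * mC) + s)) :
    ∫ k in (K' : Set G), f (x * y * k) ∂μ = 0 :=
  setIntegral_mul_eq_zero_of_trichotomy_haar μ N K' Nbar ν νbar hN hNbar hK'o hK'c f hf hcusp hcuspbar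
    (K2E3CuspFormCancellationHeights.cuspForm_trichotomy_conjLevel Ω hΩmul hΩinv K₀ K' T N Nbar A Aplus Aminus L hK₀ hy hK'y hdeep f C hC hsupp hAcover
      hIw hIw' hT hnormN hnormNbar h54N h54Nbar hplusV hplusC hminusV hminusC hx)

end Theorem20

end Summit.HodgeConjecture.HodgeConjecture.Cruxes.H413.K2E3CuspFormCancellationCore

end
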